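import Literature.NumberTheory.EllipticCurves.PAdicMeasureMomentsDetermineUnits
import Literature.NumberTheory.EllipticCurves.ProfiniteGroupDistributionTwist
import Mathlib.NumberTheory.Padics.Complex
import HarnessLib

/-!
# Push-forward of a group distribution along a `ℤ_pˣ`-valued character, and the vanishing of the
# cell-weighted character integrals from vanishing twisted moments — proofs only

Topic `NumberTheory/EllipticCurves` (siblings `ProfiniteGroupDistributionTwist` — twist and push-forward of a
`GroupDistribution` —, `PAdicMeasureMomentsDetermineUnits` — a bounded distribution on `ℤ_p` with vanishing
unit-moments `j ≥ m₀` is zero on the units). PROOFS ONLY (no definition, no named fact, no `sorry`, no instance).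

SETTING. `G` a group, `𝒰` a tower of finite-index subgroups, `ν` a `ℂ_p`-valued bounded distribution on
`G` along `𝒰`, `ρ : G →* ℤ_pˣ` a character CONGRUENT TO `1 mod pⁿ` ON `U_n` (`hρU`; the model is de Shalit's
`v`-adic character `κ_v` on `Gal(K̄/K(𝔪))` along the towers `Gal(K̄/K(𝔪_n v^{n+1}))`, II.1.7 / I.3.3 (9)), and
`χ : G → ℂ_p` a bounded function factoring through some level (a finite-order character).

* §1 `toZModPow_inv_eq_of_proj_eq` — `ρ(σ)⁻¹ mod pⁿ` depends only on the cell `σU_n` (so the level maps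
  `σ U_n ↦ ρ(σ)⁻¹ mod pⁿ` of the push-forward `ρ⁻¹_*(χ·ν) = (ν.twist χ).map …` are defined; inside §2 its
  integrals are `∫_{ℤ_p} f d(ρ⁻¹_*(χ·ν)) = ∫_G f(ρ(σ)⁻¹)·χ(σ) dν(σ)`, `integral_map` ∘ `integral_twist`);
* §2 ★★ `integral_mul_cellInd_inv_eq_zero_of_forall_moment`: if `∫ χ(σ)·(ρ(σ)⁻¹)^m dν = 0` for all `m ≥ m₀`
  then `∫ χ(σ)·𝟙[ρ(σ)⁻¹ ≡ a mod p^k] dν = 0` for every `k ≥ 1` and every unit residue `a` — the push-forward has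
  vanishing unit-moments, hence vanishes on the units (`μ_eq_zero_of_isUnit_of_forall_le`), and its level data
  are these integrals (`integral_cellInd`).

This is step (iii) of the `j = 0` uniqueness of the Katz–de Shalit measure (cell `bsd-print-cf2`, director-bsd
2026-08-30 OPTION 1; LEAD card `Cruxes/KatzDistributionsAtTwoPrint/Lines/katz_measure_two.md` v2.2): the test
functions available at `j = 0` are `κ_v^{−m}·χ`, `m ≥ m₀`.

References: [deShalit1987] E. de Shalit, *Iwasawa theory of elliptic curves with complex multiplication* (1987),
I.3.1–3.4 (p. 15–18), II.4.12 Remark (iv) (p. 67), II.4.17 (p. 77–78); [Washington1997] L. C. Washington,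
*Introduction to Cyclotomic Fields*, §7.2, §12.2.
-/

noncomputable section

open Filter Topology
open scoped Classical

namespace Literature.NumberTheory.EllipticCurves

namespace GroupDistribution

variable {G : Type*} [Group G] {𝒰 : SubgroupTower G}
variable {p : ℕ} [Fact p.Prime]

/-! ### §1. The push-forward along `σ ↦ ρ(σ)⁻¹` -/

/-- Congruence of `ρ⁻¹` along the tower: if `ρ ≡ 1 mod pⁿ` on `U_n` then `ρ(σ)⁻¹ mod pⁿ` depends only on
the cell `σ U_n`. [cite: deShalit1987, I.3.3 (9) (p. 17–18)] -/
theorem toZModPow_inv_eq_of_proj_eq (ρ : G →* ℤ_[p]ˣ) {n k : ℕ}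
    (hρU : ∀ σ : G, σ ∈ 𝒰.U n → PadicInt.toZModPow k ((ρ σ : ℤ_[p]ˣ) : ℤ_[p]) = 1)
    {σ τ : G} (h : 𝒰.proj n σ = 𝒰.proj n τ) :
    PadicInt.toZModPow k (((ρ σ)⁻¹ : ℤ_[p]ˣ) : ℤ_[p]) = PadicInt.toZModPow k (((ρ τ)⁻¹ : ℤ_[p]ˣ) : ℤ_[p]) := by
  have hmem : σ⁻¹ * τ ∈ 𝒰.U n := 𝒰.proj_eq_iff.mp h
  have h1 := hρU _ hmem
  rw [map_mul, map_inv, Units.val_mul] at h1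
  -- `(ρ τ)⁻¹ = (ρ σ)⁻¹ · ((ρ σ)⁻¹ ρ τ)⁻¹`, and the second factor reduces to `1`
  have hτ : (((ρ τ)⁻¹ : ℤ_[p]ˣ) : ℤ_[p]) = (((ρ σ)⁻¹ : ℤ_[p]ˣ) : ℤ_[p]) * ((((ρ σ)⁻¹ * ρ τ)⁻¹ : ℤ_[p]ˣ) : ℤ_[p]) := by
    rw [← Units.val_mul]
    congr 1
    rw [mul_inv_rev, inv_inv, mul_comm ((ρ τ)⁻¹) (ρ σ), ← mul_assoc, inv_mul_cancel, one_mul]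
  rw [hτ, map_mul]
  have h2 : PadicInt.toZModPow k ((((ρ σ)⁻¹ * ρ τ)⁻¹ : ℤ_[p]ˣ) : ℤ_[p]) = 1 := by
    have hu : PadicInt.toZModPow k ((((ρ σ)⁻¹ * ρ τ) : ℤ_[p]ˣ) : ℤ_[p]) *
        PadicInt.toZModPow k ((((ρ σ)⁻¹ * ρ τ)⁻¹ : ℤ_[p]ˣ) : ℤ_[p]) = 1 := by
      rw [← map_mul, Units.mul_inv, map_one]
    rw [Units.val_mul] at hu
    rw [h1, one_mul] at hu
    exact hu
  rw [h2, mul_one]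

/-- The same congruence read through any function of the residue: `f (ρ(σ)⁻¹ mod p^k)` depends only on
the cell `σ U_n`. [cite: deShalit1987, I.3.3 (9) (p. 17–18)] -/
theorem apply_toZModPow_inv_eq_of_proj_eq (ρ : G →* ℤ_[p]ˣ) {n k : ℕ}
    (hρU : ∀ σ : G, σ ∈ 𝒰.U n → PadicInt.toZModPow k ((ρ σ : ℤ_[p]ˣ) : ℤ_[p]) = 1)
    {E : Type*} (f : ZMod (p ^ k) → E) {σ τ : G} (h : 𝒰.proj n σ = 𝒰.proj n τ) :
    f (PadicInt.toZModPow k (((ρ σ)⁻¹ : ℤ_[p]ˣ) : ℤ_[p])) = f (PadicInt.toZModPow k (((ρ τ)⁻¹ : ℤ_[p]ˣ) : ℤ_[p])) := by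
  rw [toZModPow_inv_eq_of_proj_eq ρ hρU h]

/-! ### §2. Vanishing twisted moments ⇒ vanishing cell-weighted character integrals -/

/-- ★★ **From moments to congruence cells.** If `∫_G χ(σ)·(ρ(σ)⁻¹)^m dν = 0` for every `m ≥ m₀` (`χ`
bounded, factoring through a level), then for every `k ≥ 1` and every UNIT residue `a mod p^k`:
`∫_G χ(σ)·𝟙[ρ(σ)⁻¹ ≡ a mod p^k] dν = 0` (`χ` tower-continuous and bounded). Proof: the push-forward `ρ⁻¹_*(χ·ν)` on `ℤ_p` has vanishing
unit-moments `j ≥ m₀` (`ρ⁻¹` takes unit values), so it vanishes on the units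
(`BoundedDistribution.μ_eq_zero_of_isUnit_of_forall_le`), and its level datum at `a` is this integral
(`integral_cellInd` + `integral_map` ∘ `integral_twist`). [cite: deShalit1987, II.4.12 Remark (iv) (p. 67), II.4.17 (p. 77–78)]
[cite: Washington1997, §7.2] -/
theorem integral_mul_cellInd_inv_eq_zero_of_forall_moment (ν : GroupDistribution 𝒰 ℂ_[p]) (ρ : G →* ℤ_[p]ˣ)
    (hρU : ∀ (n : ℕ) (σ : G), σ ∈ 𝒰.U n → PadicInt.toZModPow n ((ρ σ : ℤ_[p]ˣ) : ℤ_[p]) = 1)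
    {χ : G → ℂ_[p]} (hχc : 𝒰.IsTowerContinuous χ)
    {C : ℝ} (hC0 : 0 ≤ C) (hC : ∀ σ, ‖χ σ‖ ≤ C) (m₀ : ℕ)
    (hmom : ∀ m : ℕ, m₀ ≤ m →
      ν.integral (fun σ ↦ χ σ * padicIntCast ℂ_[p] (((ρ σ)⁻¹ : ℤ_[p]ˣ) : ℤ_[p]) ^ m) = 0)
    {k : ℕ} (hk : 1 ≤ k) {a : ZMod (p ^ k)} (ha : IsUnit a) :
    ν.integral (fun σ ↦ χ σ * cellInd (𝕜 := ℂ_[p]) k a (((ρ σ)⁻¹ : ℤ_[p]ˣ) : ℤ_[p])) = 0 := by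
  -- the level maps `σ U_n ↦ ρ(σ)⁻¹ mod pⁿ` and the map `Φ = ρ⁻¹` over them
  let Φ : G → ℤ_[p] := fun σ ↦ (((ρ σ)⁻¹ : ℤ_[p]ˣ) : ℤ_[p])
  let φ : (n : ℕ) → G ⧸ 𝒰.U n → (ProfiniteTower.padicInt p).Cell n := fun n b ↦
    Quotient.liftOn' b (fun σ ↦ PadicInt.toZModPow n (Φ σ))
      (fun σ τ hστ ↦ toZModPow_inv_eq_of_proj_eq ρ (hρU n) (Quotient.sound' hστ))
  have hΦ : ∀ (n : ℕ) (σ : G), (ProfiniteTower.padicInt p).proj n (Φ σ) = φ n (𝒰.proj n σ) := fun n σ ↦ rfl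
  have hφ : ∀ (n : ℕ) (b : G ⧸ 𝒰.U (n + 1)), φ n (𝒰.trans n b) = (ProfiniteTower.padicInt p).trans n (φ (n + 1) b) := by
    intro n b
    induction b using QuotientGroup.induction_on with
    | H σ =>
      change PadicInt.toZModPow n (Φ σ) = (ProfiniteTower.padicInt p).trans n (PadicInt.toZModPow (n + 1) (Φ σ))
      rw [ProfiniteTower.padicInt_trans, ZMod.castHom_apply, PadicInt.cast_toZModPow n (n + 1) n.le_succ]
  -- the push-forward `D = ρ⁻¹_*(χ·ν)` and its integrals
  let D : BoundedDistribution (ProfiniteTower.padicInt p) ℂ_[p] := (ν.twist χ hχc hC0 hC).map φ hφ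
  have hint : ∀ {f : ℤ_[p] → ℂ_[p]}, UniformContinuous f → ∀ {M : ℝ}, (∀ z, ‖f z‖ ≤ M) →
      D.integral f = ν.integral (fun σ ↦ f (Φ σ) * χ σ) := by
    intro f hf M hM
    change ((ν.twist χ hχc hC0 hC).map φ hφ).integral f = _
    rw [GroupDistribution.integral_map _ φ hφ hΦ hf,
      GroupDistribution.integral_twist _ χ hχc hC0 hC (𝒰.isTowerContinuous_comp_of_over φ hΦ hf) (fun σ ↦ hM _)]
    rfl
  -- its unit-moments `j ≥ m₀` vanish (`ρ⁻¹` takes unit values)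
  have hDm : ∀ j : ℕ, m₀ ≤ j →
      D.integral (fun z : ℤ_[p] ↦ (if IsUnit z then (1 : ℂ_[p]) else 0) * padicIntCast ℂ_[p] z ^ j) = 0 := by
    intro j hj
    have huc : UniformContinuous fun z : ℤ_[p] ↦ (if IsUnit z then (1 : ℂ_[p]) else 0) * padicIntCast ℂ_[p] z ^ j :=
      CompactSpace.uniformContinuous_of_continuous
        ((BoundedDistribution.uniformContinuous_unitInd (𝕜 := ℂ_[p])).continuous.mul
          ((continuous_padicIntCast (𝕜 := ℂ_[p])).pow j))
    have hb : ∀ z : ℤ_[p], ‖(if IsUnit z then (1 : ℂ_[p]) else 0) * padicIntCast ℂ_[p] z ^ j‖ ≤ 1 := fun z ↦ by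
      rw [norm_mul, norm_pow, norm_padicIntCast]
      refine mul_le_one₀ ?_ (pow_nonneg (norm_nonneg _) _) (pow_le_one₀ (norm_nonneg _) (PadicInt.norm_le_one z))
      split_ifs <;> simp
    rw [hint huc hb]
    refine Eq.trans (ν.integral_congr fun σ ↦ ?_) (hmom j hj)
    change (if IsUnit (Φ σ) then (1 : ℂ_[p]) else 0) * padicIntCast ℂ_[p] (Φ σ) ^ j * χ σ = χ σ * padicIntCast ℂ_[p] (Φ σ) ^ j
    rw [if_pos (Units.isUnit _), one_mul, mul_comm]
  -- so it vanishes on the units (brick 1) …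
  have hμ : D.μ k a = 0 := BoundedDistribution.μ_eq_zero_of_isUnit_of_forall_le D m₀ hDm hk ha
  -- … and its level datum at `a` is the integral in question
  rw [← BoundedDistribution.integral_cellInd (D := D) k a,
    hint (uniformContinuous_cellInd k a) (fun z ↦ norm_cellInd_le k a z)] at hμ
  rw [← hμ]
  exact ν.integral_congr fun σ ↦ mul_comm _ _

end GroupDistribution

end Literature.NumberTheory.EllipticCurves

end
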